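import Summits.FinalStateConjecture.FinalStateConjecture.Theorems.PhaseMixingCaptureNearExtremalKappaCaptureThermalTimeStabilityCentre
import Summits.FinalStateConjecture.FinalStateConjecture.Theorems.EIHFluxBalanceModulatedKerrHandoffExteriorLastExitHorizon
import Literature.Geometry.Lorentzian.CausalityPushUp
import HarnessLib

/-!
# Crux `ClusterCompleteness.OmegaLimitMultiKerr` (stmt-FinalStateConjecture-14664), line `Sketch` —
# the `N = 1` exact-Kerr certificate, part 3/3: no escape through the event horizon, and exhaustion
# of the chronological past of the late exterior by the exterior slabs `{t* = τ₁, r > r₊}`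

Registered stub `kerrSlab_exhaustion` of the assembly `recurs_kerrSlab_development_of` (the exact
sub-extremal Kerr black hole, realised as the vacuum Cauchy development `KerrSlab.development hM ha`
of the Kerr–Schild data `Kerr.data M a M`, `0 < M`, `|a| < M`, on the slab domain
`KerrSlab.domain a M ⊆ Kerr.region a M ⊆ E4`; points `p` have Kerr–Schild coordinates `p.1.1`,
chart time `t*(p) = p.1.1 0` and Kerr–Schild radius `r(p) = Kerr.radius a p.1.1`).

* `kerrSlab_exhaustion` — granted the forward-helix fact (every later chart time is reached from an
  exterior point `r > r₊`, `t* ≥ 0`, at the same radius, inside its chronological future; this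
  is part (b) of the neighbouring stub `kerrSlab_helix`, taken here as a HYPOTHESIS), every point
  `p` of the chronological past `I⁻({t* > τ₀, r > r₊})` (`τ₀ ≥ 0`) of the late exterior satisfies
  (i) `r(p) > r₊`, and (ii) `p ∈ J⁻({t* = τ₁, r > r₊})` for every `τ₁ ≥ τ₀` with `t*(p) ≤ τ₁`.

Proof. `p ∈ I⁻(S)` is witnessed by a late exterior point `q` (`t*(q) > τ₀`, `r(q) > r₊`) and a
past-directed timelike curve from `q` to `p`; read forwards (`IsFutureTimelikeCurveOn.reverseParam`)
it is a future timelike curve `μ : [s₀, s₁] → slab` from `p` to `q`, whose chart expression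
`Subtype.val ∘ μ` is a future timelike curve of the Kerr chart
(`LorentzianMetric.isFutureTimelikeCurveOn_restrict_iff`, the chart/sub-spacetime dictionary).
(i) is exterior persistence along future timelike chart curves, read backwards from `q`
(`EIHFluxBalance.ExteriorLastExit.rPlus_lt_radius_of_le'`: nothing leaves the black hole,
Hawking–Ellis 1973, Prop. 9.2.1; Dafermos–Rodnianski–Shlapentokh-Rothman arXiv:1402.7034, §2.2.5):
`r > r₊` all along `μ`. (ii) If `τ₁ ≤ t*(q)`, the chart time — continuous along `μ` by the cone
comparison with Minkowski spacetime (`CollarCauchy.minkowski_curve`,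
`Minkowski.continuousOn_time`) — takes the value `τ₁` at some `μ σ` (intermediate value theorem),
a point of the slab by (i), and `p = μ s₀` is either that point or chronologically precedes it
along `μ|[s₀, σ]`; if `t*(q) < τ₁`, the helix hypothesis lifts `q` to a slab point `q'` with
`q ≪ q'`, and `p ≪ q ≪ q'` (`LorentzianMetric.mem_chronologicalFuture_trans`). In both cases
`I⁻ ⊆ J⁻` and monotonicity of `J⁻` conclude (O'Neill 1983, Ch. 14, pp. 402–403: time duality,
`I⁺ ⊆ J⁺`, transitivity of `≪`).

Everything is proved from tree material; no definition, no named fact is consumed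
(`[Kerr.Facts] [Kerr.SliceFacts]` are the standing instance hypotheses of `Kerr.data`).

References: S. W. Hawking, G. F. R. Ellis, *The large scale structure of space-time* (CUP 1973),
Prop. 9.2.1; B. O'Neill, *Semi-Riemannian geometry* (Academic Press 1983), Ch. 14, pp. 402–403;
M. Dafermos, I. Rodnianski, Y. Shlapentokh-Rothman, arXiv:1402.7034, §2.2.5.
-/

-- every `Summit.FinalStateConjecture.FinalStateConjecture.…` name repeats the summit = sub-problem segment (D-0017 layout)
set_option linter.dupNamespace false

noncomputable section

open scoped Manifold ContDiff Topology ENNReal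
open Set Filter TopologicalSpace Function

namespace Summit.FinalStateConjecture.FinalStateConjecture.Theorems.ClusterCompleteness

open Literature.Geometry.Lorentzian
open Summit.FinalStateConjecture.FinalStateConjecture.Theorems.NearExtremalKappaCapture.UnitTemperatureFrontFace
open Summit.FinalStateConjecture.FinalStateConjecture.Theorems.EIHFluxBalance.ExteriorLastExit
open Summit.FinalStateConjecture.FinalStateConjecture.Theorems.SwallowTheDatum.KerrShieldedSettles.CollarCauchy

/-- **No escape and exhaustion in the Kerr slab development** (registered stub
`kerrSlab_exhaustion` of the crux's line `Sketch`). In the vacuum Cauchy development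
`KerrSlab.development hM ha` of the exact sub-extremal Kerr data (`0 < M`, `|a| < M`), granted the
forward-helix fact (from every point with `r > r₊`, `t* ≥ 0` every later chart time is reached at
the same radius inside its chronological future — part (b) of `kerrSlab_helix`, a hypothesis here):
a point `p` of the chronological past of the late exterior set `{t* > τ₀, r > r₊}` (`τ₀ ≥ 0`) has
`r(p) > r₊` (nothing leaves the black hole along the future timelike curve from `p` to the exterior,
`rPlus_lt_radius_of_le'`), and for every `τ₁ ≥ τ₀` with `t*(p) ≤ τ₁` it lies in the causal past of
the exterior slab `{t* = τ₁, r > r₊}` (intermediate value theorem for the chart time along that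
curve if `τ₁ ≤ t*(q)`, the helix from `q` otherwise; then `I⁻ ⊆ J⁻`). Hawking–Ellis 1973,
Prop. 9.2.1; O'Neill 1983, Ch. 14, pp. 402–403; DRSR arXiv:1402.7034, §2.2.5. [folklore] -/
theorem kerrSlab_exhaustion : ∀ [Kerr.Facts] [Kerr.SliceFacts] {M a : ℝ} (hM : 0 < M) (ha : |a| < M),
    (∀ p : (KerrSlab.development hM ha).carrier,
      Kerr.rPlus M a < Kerr.radius a p.1.1 → 0 ≤ p.1.1 0 → ∀ T : ℝ, p.1.1 0 < T →
        ∃ q : (KerrSlab.development hM ha).carrier,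
          Kerr.radius a q.1.1 = Kerr.radius a p.1.1 ∧ q.1.1 0 = T ∧
            q ∈ (KerrSlab.development hM ha).metric.chronologicalFuture
              (KerrSlab.development hM ha).timeOrientation {p}) →
    ∀ {τ₀ : ℝ}, 0 ≤ τ₀ → ∀ {p : (KerrSlab.development hM ha).carrier},
    p ∈ (KerrSlab.development hM ha).metric.chronologicalPast
      (KerrSlab.development hM ha).timeOrientation
        {q | τ₀ < q.1.1 0 ∧ Kerr.rPlus M a < Kerr.radius a q.1.1} →
    Kerr.rPlus M a < Kerr.radius a p.1.1 ∧
      ∀ τ₁ : ℝ, τ₀ ≤ τ₁ → p.1.1 0 ≤ τ₁ →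
        p ∈ (KerrSlab.development hM ha).metric.causalPast
          (KerrSlab.development hM ha).timeOrientation
            {q | q.1.1 0 = τ₁ ∧ Kerr.rPlus M a < Kerr.radius a q.1.1} := by
  intro _ _ M a hM ha hhelix τ₀ hτ₀ p hp
  -- the witnessing past-directed timelike curve `γ` from a late exterior point `q` down to `p`
  obtain ⟨q, ⟨hq0, hqr⟩, γ, s₀, s₁, hs, hγ, hγ0, hγ1⟩ := hp
  -- read forwards: a future timelike curve `μ` of the development from `p = μ s₀` to `q = μ s₁`
  set μ : ℝ → (KerrSlab.development hM ha).carrier := fun s ↦ γ (s₀ + s₁ - s) with hμ_def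
  have hμ : (KerrSlab.development hM ha).metric.IsFutureTimelikeCurveOn
      (KerrSlab.development hM ha).timeOrientation μ (Icc s₀ s₁) :=
    LorentzianMetric.isFutureTimelikeCurveOn_reverse_reverse_iff.mp hγ.reverseParam
  have hμ0 : μ s₀ = p := by
    show γ (s₀ + s₁ - s₀) = p
    rw [add_sub_cancel_left]
    exact hγ1
  have hμ1 : μ s₁ = q := by
    show γ (s₀ + s₁ - s₁) = q
    rw [add_sub_cancel_right]
    exact hγ0
  -- its chart expression is a future timelike curve of the Kerr chart `Kerr.region a M`
  have hc : (Kerr.smoothMetric M a M).IsFutureTimelikeCurveOn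
      ((Kerr.timeOrientation M a M hM.le).ofLE le_top) (Subtype.val ∘ μ) (Icc s₀ s₁) :=
    (LorentzianMetric.isFutureTimelikeCurveOn_restrict_iff _ _ _ _ _).1 hμ
  -- (i) nothing escapes through the event horizon: `r > r₊` all along `μ`, as `r(q) > r₊`
  have hr : ∀ s ∈ Icc s₀ s₁, Kerr.rPlus M a < Kerr.radius a (μ s).1.1 := by
    intro s hσ
    have h1 : Kerr.rPlus M a < Kerr.radius a (μ s₁).1.1 := by
      rw [hμ1]
      exact hqr
    exact rPlus_lt_radius_of_le' ha ordConnected_Icc hc hσ (right_mem_Icc.2 hs.le) hσ.2 h1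
  have hrp : Kerr.rPlus M a < Kerr.radius a p.1.1 := by
    have h := hr s₀ (left_mem_Icc.2 hs.le)
    rwa [hμ0] at h
  refine ⟨hrp, fun τ₁ _ hp1 ↦ ?_⟩
  rcases le_or_gt τ₁ (q.1.1 0) with hle | hlt
  · -- `t*(p) ≤ τ₁ ≤ t*(q)`: the chart time, continuous along `μ`, takes the value `τ₁` on `μ`
    have hcont : ContinuousOn (fun s ↦ (μ s).1.1 0) (Icc s₀ s₁) :=
      Minkowski.continuousOn_time (minkowski_curve hc)
    have hτI : τ₁ ∈ Icc ((μ s₀).1.1 0) ((μ s₁).1.1 0) := by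
      rw [hμ0, hμ1]
      exact ⟨hp1, hle⟩
    obtain ⟨σ, hσ, hστ⟩ := intermediate_value_Icc hs.le hcont hτI
    have hmem : μ σ ∈ {q : (KerrSlab.development hM ha).carrier |
        q.1.1 0 = τ₁ ∧ Kerr.rPlus M a < Kerr.radius a q.1.1} := ⟨hστ, hr σ hσ⟩
    rcases hσ.1.eq_or_lt with h0 | hσ0
    · -- `p` itself lies on the slab
      have hpσ : p = μ σ := by rw [← h0, hμ0]
      rw [hpσ]
      exact LorentzianMetric.subset_causalPast _ _ _ hmem
    · -- `p ≪ μ σ` along `μ|[s₀, σ]`, and `I⁻ ⊆ J⁻`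
      have h1 : μ σ ∈ (KerrSlab.development hM ha).metric.chronologicalFuture
          (KerrSlab.development hM ha).timeOrientation {p} :=
        ⟨p, rfl, μ, s₀, σ, hσ0, hμ.mono (Icc_subset_Icc_right hσ.2), hμ0, rfl⟩
      exact LorentzianMetric.causalFuture_mono (singleton_subset_iff.2 hmem)
        (LorentzianMetric.chronologicalFuture_subset_causalFuture _ _ _
          (LorentzianMetric.mem_chronologicalPast_of_mem_chronologicalFuture h1))
  · -- `t*(q) < τ₁`: climb the forward helix from `q` to the slab, `p ≪ q ≪ q'`
    obtain ⟨q', hq'r, hq't, hq'⟩ := hhelix q hqr (hτ₀.trans hq0.le) τ₁ hlt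
    have hmem : q' ∈ {q : (KerrSlab.development hM ha).carrier |
        q.1.1 0 = τ₁ ∧ Kerr.rPlus M a < Kerr.radius a q.1.1} := ⟨hq't, hq'r ▸ hqr⟩
    have h1 : q ∈ (KerrSlab.development hM ha).metric.chronologicalFuture
        (KerrSlab.development hM ha).timeOrientation {p} :=
      ⟨p, rfl, μ, s₀, s₁, hs, hμ, hμ0, hμ1⟩
    exact LorentzianMetric.causalFuture_mono (singleton_subset_iff.2 hmem)
      (LorentzianMetric.chronologicalFuture_subset_causalFuture _ _ _
        (LorentzianMetric.mem_chronologicalPast_of_mem_chronologicalFuture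
          (LorentzianMetric.mem_chronologicalFuture_trans h1 hq')))

end Summit.FinalStateConjecture.FinalStateConjecture.Theorems.ClusterCompleteness

end
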